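import Summits.CriticalPhenomena.Ising3DConformalLimit.Theorems.GapForcesFarMerging.Negative.IsingCertificate

/-!
# `GapForcesFarMerging`, line `rp-unpinch-single-passage`: degenerate instances of the stub set
# (deep-refute seat `drefute-stmt-CriticalPhenomena-4468`, 2026-08-16)

Kernel-checked bookkeeping for the hypothesis-mutation pass over the five registered stubs of
`Cruxes/GapForcesFarMerging/Lines/rp-unpinch-single-passage.lean` (shapes from
`Negative.LineShapes`, Ising certificate `softPackageNoBubble_criticalCorr` from
`Negative.IsingCertificate`). Everything here is SOFT (holds for every triple with the
bubble-free soft package) and is then instantiated at `(cc2, criticalTwoPoint 3, criticalCorr 3 4)`: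

* `TS_e₂_zero`, `singlePinchPositive_false_without_one_le`: at `m = 0` the two far targets
  `up 0 = dn 0 = 0` coincide and the single-pinch truncation `T(e₂; 0) = ⟨σ₀σ_{e₂}⟩ - ⟨σ₀σ_{e₂}⟩·1`
  vanishes, so the guard `1 ≤ m` of `stub_singlePinchPositive` is load-bearing
  (`¬ ∀ m, 0 < T(e₂; m)`).
* `quasiMultiplicative_instance_s_zero`: the `s = 0` instances of `stub_quasiMultiplicative` hold for
  EVERY real `c` (the left side is `c · 0 · 𝒜(0; m) = 0 ≤ 𝒜(e₂; m)` by GKS II), so its guard `1 ≤ s`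
  is decorative.
* `unpinchedEnvelope_instance_m_zero`: the `m = 0` instance of `stub_unpinchedEnvelope` holds
  (`0 ≤ 0 ≤ 2`), so its guard `1 ≤ m` is decorative.
* `rpUnpinch_instance_diag`: the diagonal instances `z = y` of `stub_rpUnpinch` hold with both sides
  `0` (`σ_y² = 1`), for every mirror `m` and every `y`, far side or not — coincident targets carry
  no information and no junk.
-/

noncomputable section

namespace Summit.CriticalPhenomena.Ising3DConformalLimit.Theorems.GapForcesFarMerging.Negative

open Literature.Probability.LatticeModels
open Summit.CriticalPhenomena.Ising3DConformalLimit.Theses.EnergyNotSigmaSquared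

namespace DrefuteLocal

def xR (m : ℕ) : Site 3 := Pi.single 0 (2 * (m : ℤ))
def up (m : ℕ) : Site 3 := xR m + Pi.single 1 (m : ℤ)
def dn (m : ℕ) : Site 3 := xR m - Pi.single 1 (m : ℤ)
def mirror (m : ℕ) (y : Site 3) : Site 3 := y - Pi.single 0 (2 * (y 0 - m))
def src (s : ℕ) : Site 3 := Pi.single 1 (s : ℤ)
section shapes
variable (S : Site 3 → Site 3 → ℝ) (T : Site 3 → ℝ) (F : (Fin 4 → Site 3) → ℝ)
def pairCovS (a b c d : Site 3) : ℝ := F ![a, b, c, d] - S a b * S c d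
def TS (b : Site 3) (m : ℕ) : ℝ := pairCovS S F 0 b (up m) (dn m)
def NparS (b : Site 3) (m : ℕ) : ℝ := S 0 (dn m) * S b (up m)
def avoidS (b : Site 3) (m : ℕ) : ℝ := TS S F b m / NparS S b m
end shapes

/-! ## The configurations at `m = 0` / `s = 0` -/

/-- `xR 0 = 0`. [folklore] -/
theorem xR_zero : xR 0 = 0 := by
  simp [xR]

/-- `up 0 = 0`. [folklore] -/
theorem up_zero_eq : up 0 = 0 := by
  simp [up, xR]

/-- `dn 0 = 0`. [folklore] -/
theorem dn_zero_eq : dn 0 = 0 := by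
  simp [dn, xR]

/-- `src 0 = 0`. [folklore] -/
theorem src_zero : src 0 = 0 := by
  simp [src]

section soft

variable {S : Site 3 → Site 3 → ℝ} {T : Site 3 → ℝ} {F : (Fin 4 → Site 3) → ℝ}

/-! ## Relabelling helpers over the package -/

/-- Transposition `(0 1)` of the arguments. [folklore] -/
theorem F_swap01' (hP : SoftPackageNoBubble S T F) (a b c d : Site 3) :
    F ![b, a, c, d] = F ![a, b, c, d] := by
  have h : (![a, b, c, d] : Fin 4 → Site 3) ∘ ⇑(Equiv.swap (0 : Fin 4) 1) = ![b, a, c, d] := by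
    funext i; fin_cases i <;> simp [Equiv.swap_apply_of_ne_of_ne]
  rw [← h, hP.swap01]

/-- Transposition `(1 2)` of the arguments. [folklore] -/
theorem F_swap12' (hP : SoftPackageNoBubble S T F) (a b c d : Site 3) :
    F ![a, c, b, d] = F ![a, b, c, d] := by
  have h : (![a, b, c, d] : Fin 4 → Site 3) ∘ ⇑(Equiv.swap (1 : Fin 4) 2) = ![a, c, b, d] := by
    funext i; fin_cases i <;> simp [Equiv.swap_apply_of_ne_of_ne]
  rw [← h, hP.swap12]

/-- Transposition `(2 3)` of the arguments. [folklore] -/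
theorem F_swap23' (hP : SoftPackageNoBubble S T F) (a b c d : Site 3) :
    F ![a, b, d, c] = F ![a, b, c, d] := by
  have h : (![a, b, c, d] : Fin 4 → Site 3) ∘ ⇑(Equiv.swap (2 : Fin 4) 3) = ![a, b, d, c] := by
    funext i; fin_cases i <;> simp [Equiv.swap_apply_of_ne_of_ne]
  rw [← h, hP.swap23]

/-- `⟨σ_aσ_bσ_yσ_y⟩ = ⟨σ_aσ_b⟩` over the package (coincident LAST pair; the package field
`coincide` is the coincident FIRST pair). [folklore] -/
theorem F_coincide_last (hP : SoftPackageNoBubble S T F) (a b y : Site 3) :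
    F ![a, b, y, y] = S a b :=
  calc F ![a, b, y, y] = F ![a, y, b, y] := (F_swap12' hP a b y y).symm
    _ = F ![y, a, b, y] := (F_swap01' hP a y b y).symm
    _ = F ![y, a, y, b] := (F_swap23' hP y a b y).symm
    _ = F ![y, y, a, b] := (F_swap12' hP y a y b).symm
    _ = S a b := hP.coincide y a b

/-- The avoidance functional is non-negative (GKS II over a positive normalisation). [folklore] -/
theorem avoidS_nonneg' (hP : SoftPackageNoBubble S T F) (b : Site 3) (m : ℕ) :
    0 ≤ avoidS S F b m := by
  unfold avoidS TS pairCovS NparS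
  refine div_nonneg ?_ (mul_pos (hP.pos _ _) (hP.pos _ _)).le
  have h := hP.griffiths ![0, b, up m, dn m]
  simp only [Matrix.cons_val_zero, Matrix.cons_val_one, Matrix.cons_val] at h
  linarith

/-! ## Stub 3 `stub_singlePinchPositive`: the guard `1 ≤ m` is load-bearing -/

/-- At `m = 0` the single-pinch truncation vanishes: `T(e₂; 0) = F(0,e₂,0,0) - S(0,e₂)S(0,0) = 0`. [folklore] -/
theorem TS_e₂_zero (hP : SoftPackageNoBubble S T F) : TS S F e₂ 0 = 0 := by
  unfold TS
  rw [up_zero_eq, dn_zero_eq]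
  unfold pairCovS
  rw [F_coincide_last hP, hP.diag]
  ring

/-- Hence `∀ m, 0 < T(e₂; m)` (stub 3 without its guard) fails over every packaged triple. [folklore] -/
theorem singlePinchPositive_needs_one_le (hP : SoftPackageNoBubble S T F) :
    ¬ ∀ m : ℕ, 0 < TS S F e₂ m := by
  intro h
  have h0 := h 0
  rw [TS_e₂_zero hP] at h0
  exact lt_irrefl _ h0

/-! ## Stub 4 `stub_quasiMultiplicative`: the guard `1 ≤ s` is decorative -/

/-- `𝒜(e₂; 0) = 0`. [folklore] -/
theorem avoidS_e₂_zero (hP : SoftPackageNoBubble S T F) : avoidS S F e₂ 0 = 0 := by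
  unfold avoidS
  rw [TS_e₂_zero hP, zero_div]

/-- The `s = 0` instances of quasi-multiplicativity hold for every real `c` and every `m`. [folklore] -/
theorem quasiMultiplicative_at_s_zero (hP : SoftPackageNoBubble S T F) (c : ℝ) (m : ℕ) :
    c * avoidS S F e₂ 0 * avoidS S F (src 0) m ≤ avoidS S F e₂ m := by
  rw [avoidS_e₂_zero hP, mul_zero, zero_mul]
  exact avoidS_nonneg' hP e₂ m

/-! ## Stub 2 `stub_unpinchedEnvelope`: the guard `1 ≤ m` is decorative -/

/-- The `m = 0` instance of the un-pinched envelope holds (`0 ≤ 0 ≤ 2`). [folklore] -/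
theorem unpinchedEnvelope_at_m_zero (hP : SoftPackageNoBubble S T F) :
    0 ≤ pairCovS S F (Pi.single 1 ((0 : ℕ) : ℤ)) (Pi.single 1 (-((0 : ℕ) : ℤ))) (up 0) (dn 0) ∧
      pairCovS S F (Pi.single 1 ((0 : ℕ) : ℤ)) (Pi.single 1 (-((0 : ℕ) : ℤ))) (up 0) (dn 0) ≤
        2 * T (xR 0) ^ 2 := by
  have h1 : (Pi.single 1 ((0 : ℕ) : ℤ) : Site 3) = 0 := by simp
  have h2 : (Pi.single 1 (-((0 : ℕ) : ℤ)) : Site 3) = 0 := by simp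
  rw [h1, h2, up_zero_eq, dn_zero_eq, xR_zero]
  unfold pairCovS
  rw [hP.coincide, hP.two, hP.diag]
  norm_num

/-! ## Stub 1 `stub_rpUnpinch`: the diagonal instances `z = y` are trivially true (no junk) -/

/-- `⟨σ₀σ_{e₂} ; σ_yσ_y⟩ = 0`. [folklore] -/
theorem pairCovS_diag_right (hP : SoftPackageNoBubble S T F) (a b y : Site 3) :
    pairCovS S F a b y y = 0 := by
  unfold pairCovS
  rw [F_coincide_last hP, hP.diag]
  ring

/-- `⟨σ_aσ_a ; σ_yσ_y⟩ = 0`. [folklore] -/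
theorem pairCovS_diag_both (hP : SoftPackageNoBubble S T F) (a y : Site 3) :
    pairCovS S F a a y y = 0 := by
  unfold pairCovS
  rw [hP.coincide, hP.diag, hP.diag]
  ring

/-- Every diagonal instance (`z = y`, any mirror `m`, any `y`) of the RP minor holds: `0 ≤ 0`. [folklore] -/
theorem rpUnpinch_at_diag (hP : SoftPackageNoBubble S T F) (m : ℕ) (y : Site 3) :
    pairCovS S F 0 e₂ y y ^ 2 ≤
      pairCovS S F 0 e₂ (xR m) (xR m + e₂) * pairCovS S F (mirror m y) (mirror m y) y y := by
  rw [pairCovS_diag_right hP, pairCovS_diag_both hP]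
  simp

/-! ## Stub 1 `stub_rpUnpinch`: the half-space guards `m ≤ y 0`, `m ≤ z 0` are load-bearing -/

/-- Component bound for the sup norm on `Site 3`. [folklore] -/
theorem abs_apply_le_norm' (v : Site 3) (i : Fin 3) : |((v i : ℤ) : ℝ)| ≤ ‖v‖ := by
  have h := norm_le_pi_norm v i
  rwa [Int.norm_eq_abs] at h

/-- The package's upper bound read through one coordinate: `S(0,x) ≤ max C 0 / r` as soon as
`r ≤ |x i|`. [folklore] -/
theorem S_le_of_coord {S : Site 3 → Site 3 → ℝ} {C : ℝ}
    (hC : ∀ x : Site 3, x ≠ 0 → S 0 x ≤ C * (‖x‖ : ℝ) ^ (-(1 : ℝ)))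
    {x : Site 3} (hx : x ≠ 0) {r : ℝ} (hr : 0 < r) (i : Fin 3) (hrx : r ≤ |((x i : ℤ) : ℝ)|) :
    S 0 x ≤ max C 0 * r⁻¹ := by
  have h1 := hC x hx
  have hnorm : r ≤ ‖x‖ := hrx.trans (abs_apply_le_norm' x i)
  have hnpos : 0 < ‖x‖ := hr.trans_le hnorm
  rw [Real.rpow_neg_one] at h1
  calc S 0 x ≤ C * ‖x‖⁻¹ := h1
    _ ≤ max C 0 * ‖x‖⁻¹ := mul_le_mul_of_nonneg_right (le_max_left _ _) (inv_nonneg.2 hnpos.le)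
    _ ≤ max C 0 * r⁻¹ := mul_le_mul_of_nonneg_left (inv_anti₀ hr hnorm) (le_max_right _ _)

/-- `⟨σ₀σ_{e₂}⟩ < 1` over the package: otherwise GKS II along the axis forces `⟨σ₀σ_{ke₂}⟩ = 1`
for all `k`, against the decay `≤ C‖x‖⁻¹`. [folklore] -/
theorem S_e₂_lt_one (hP : SoftPackageNoBubble S T F) : S 0 e₂ < 1 := by
  by_contra hnot
  have hG1 : S 0 e₂ = 1 := le_antisymm (hP.le_one _ _) (not_lt.1 hnot)
  have hall : ∀ k : ℕ, S 0 (Pi.single 1 (k : ℤ)) = 1 := by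
    intro k
    induction k with
    | zero => simp [hP.diag]
    | succ k ih =>
      refine le_antisymm (hP.le_one _ _) ?_
      have hg := hP.gks_pair 0 (Pi.single 1 (k : ℤ)) (Pi.single 1 ((k + 1 : ℕ) : ℤ))
      have ht : S (Pi.single 1 (k : ℤ)) (Pi.single 1 ((k + 1 : ℕ) : ℤ)) = S 0 e₂ := by
        have h2 := hP.transl 0 e₂ (Pi.single 1 (k : ℤ))
        rw [zero_add] at h2
        rw [← h2]
        congr 1
        rw [show ((k + 1 : ℕ) : ℤ) = 1 + (k : ℤ) by push_cast; ring, Pi.single_add]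
      rw [ht, hG1, ih, one_mul] at hg
      exact hg
  obtain ⟨C, hC⟩ := hP.upper
  obtain ⟨k, hk⟩ := exists_nat_gt (max C 0)
  have hkpos : (0 : ℝ) < k := (le_max_right C 0).trans_lt hk
  have hk0 : 0 < k := by exact_mod_cast hkpos
  have hx : (Pi.single 1 (k : ℤ) : Site 3) ≠ 0 := by
    intro h0
    have := congrFun h0 1
    simp at this
    omega
  have hb : S 0 (Pi.single 1 (k : ℤ)) ≤ max C 0 * (k : ℝ)⁻¹ :=
    S_le_of_coord hC hx hkpos 1 (by simp)
  rw [hall k, ← div_eq_mul_inv, le_div_iff₀ hkpos, one_mul] at hb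
  linarith

/-- The `(y, z) = (0, e₂)` entry of the minor is the variance of the energy density,
`1 - ⟨σ₀σ_{e₂}⟩²`. [folklore] -/
theorem pairCovS_energy_self (hP : SoftPackageNoBubble S T F) :
    pairCovS S F 0 e₂ 0 e₂ = 1 - S 0 e₂ ^ 2 := by
  unfold pairCovS
  rw [F_swap12' hP 0 0 e₂ e₂, hP.coincide, hP.diag]
  ring

/-- The GAP entry of the minor decays: `0 ≤ ⟨σ₀σ_{e₂} ; σ_{2me₁}σ_{2me₁+e₂}⟩ ≤ max C 0 / m`
(GKS II; Lebowitz + the two cross Wick terms + `S ≤ C‖·‖⁻¹`, `S ≤ 1`). [folklore] -/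
theorem gapEntry_bounds (hP : SoftPackageNoBubble S T F) {C : ℝ}
    (hC : ∀ x : Site 3, x ≠ 0 → S 0 x ≤ C * (‖x‖ : ℝ) ^ (-(1 : ℝ))) {m : ℕ} (hm : 1 ≤ m) :
    0 ≤ pairCovS S F 0 e₂ (xR m) (xR m + e₂) ∧
      pairCovS S F 0 e₂ (xR m) (xR m + e₂) ≤ max C 0 * (m : ℝ)⁻¹ := by
  have hm0 : (0 : ℝ) < m := by exact_mod_cast hm
  have hmne : (m : ℝ) ≠ 0 := hm0.ne'
  have h2m : (0 : ℝ) < 2 * m := by positivity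
  have hxRne : xR m ≠ 0 := by
    intro h0; have := congrFun h0 0; simp [xR] at this; omega
  have hxRe : xR m - e₂ ≠ 0 := by
    intro h0; have := congrFun h0 1; simp [xR, e₂] at this
  have hc0 : ((xR m) 0 : ℤ) = 2 * m := by simp [xR]
  have hc0' : ((xR m - e₂) 0 : ℤ) = 2 * m := by simp [xR, e₂]
  have hS1 : S 0 (xR m) ≤ max C 0 * (2 * (m : ℝ))⁻¹ :=
    S_le_of_coord hC hxRne h2m 0 (by rw [hc0]; push_cast; exact le_abs_self _)
  have hS2 : S e₂ (xR m) ≤ max C 0 * (2 * (m : ℝ))⁻¹ := by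
    have ht : S e₂ (xR m) = S 0 (xR m - e₂) := by
      have := hP.transl 0 (xR m - e₂) e₂
      rwa [zero_add, sub_add_cancel] at this
    rw [ht]
    exact S_le_of_coord hC hxRe h2m 0 (by rw [hc0']; push_cast; exact le_abs_self _)
  constructor
  · unfold pairCovS
    have hg := hP.griffiths ![0, e₂, xR m, xR m + e₂]
    simp only [Matrix.cons_val_zero, Matrix.cons_val_one, Matrix.cons_val] at hg
    linarith
  · unfold pairCovS
    have hl := hP.lebowitz ![0, e₂, xR m, xR m + e₂]
    simp only [Matrix.cons_val_zero, Matrix.cons_val_one, Matrix.cons_val] at hl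
    have ha : S 0 (xR m) * S e₂ (xR m + e₂) ≤ max C 0 * (2 * (m : ℝ))⁻¹ * 1 :=
      mul_le_mul hS1 (hP.le_one _ _) (hP.pos _ _).le (by positivity)
    have hb : S 0 (xR m + e₂) * S e₂ (xR m) ≤ 1 * (max C 0 * (2 * (m : ℝ))⁻¹) :=
      mul_le_mul (hP.le_one _ _) hS2 (hP.pos _ _).le zero_le_one
    have hsum : max C 0 * (2 * (m : ℝ))⁻¹ * 1 + 1 * (max C 0 * (2 * (m : ℝ))⁻¹) =
        max C 0 * (m : ℝ)⁻¹ := by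
      field_simp
      ring
    linarith

/-- The pair–pair entry of the minor is at most `3` (in fact `≤ 2`): Lebowitz + `S ≤ 1`. [folklore] -/
theorem pairCovS_le_three (hP : SoftPackageNoBubble S T F) (a b c d : Site 3) :
    pairCovS S F a b c d ≤ 3 := by
  unfold pairCovS
  have hl := hP.lebowitz ![a, b, c, d]
  simp only [Matrix.cons_val_zero, Matrix.cons_val_one, Matrix.cons_val] at hl
  have q1 : S a c * S b d ≤ 1 := mul_le_one₀ (hP.le_one _ _) (hP.pos _ _).le (hP.le_one _ _)
  have q2 : S a d * S b c ≤ 1 := mul_le_one₀ (hP.le_one _ _) (hP.pos _ _).le (hP.le_one _ _)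
  linarith

/-- **The half-space guards of `stub_rpUnpinch` are load-bearing**: with `(m ≤ y 0, m ≤ z 0)`
dropped, the minor fails at `(y, z) = (0, e₂)` for every large mirror offset `m` (left side the
fixed positive number `(1 - ⟨σ₀σ_{e₂}⟩²)²`, right side `≤ 3·max C 0/m`), over EVERY triple with
the bubble-free soft package — so any proof of stub 1 must use the half-space hypotheses
(reflection positivity, not mere symmetry). [folklore] -/
theorem rpUnpinch_needs_halfspace (hP : SoftPackageNoBubble S T F) :
    ¬ ∀ (m : ℕ) (y z : Site 3),
        pairCovS S F 0 e₂ y z ^ 2 ≤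
          pairCovS S F 0 e₂ (xR m) (xR m + e₂) * pairCovS S F (mirror m y) (mirror m z) y z := by
  intro h
  obtain ⟨C, hC⟩ := hP.upper
  have hC'0 : 0 ≤ max C 0 := le_max_right _ _
  have hδ : 0 < (1 - S 0 e₂ ^ 2) ^ 2 := by
    have h0 : 0 ≤ S 0 e₂ := (hP.pos _ _).le
    have h1 : S 0 e₂ < 1 := S_e₂_lt_one hP
    have h2 : S 0 e₂ ^ 2 < 1 := by nlinarith
    have h3 : 0 < 1 - S 0 e₂ ^ 2 := by linarith
    positivity
  set δ : ℝ := (1 - S 0 e₂ ^ 2) ^ 2 with hδdef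
  obtain ⟨m, hm⟩ := exists_nat_gt (3 * max C 0 / δ + 1)
  have hm1r : (1 : ℝ) ≤ m := by
    have : 0 ≤ 3 * max C 0 / δ := by positivity
    linarith
  have hm1 : 1 ≤ m := by exact_mod_cast hm1r
  have hm0 : (0 : ℝ) < m := by exact_mod_cast hm1
  have key := h m 0 e₂
  rw [pairCovS_energy_self hP] at key
  obtain ⟨hE0, hE1⟩ := gapEntry_bounds hP hC hm1
  have hP3 := pairCovS_le_three hP (mirror m 0) (mirror m e₂) 0 e₂
  have hR : pairCovS S F 0 e₂ (xR m) (xR m + e₂) * pairCovS S F (mirror m 0) (mirror m e₂) 0 e₂ ≤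
      3 * (max C 0 * (m : ℝ)⁻¹) :=
    calc pairCovS S F 0 e₂ (xR m) (xR m + e₂) * pairCovS S F (mirror m 0) (mirror m e₂) 0 e₂
        ≤ pairCovS S F 0 e₂ (xR m) (xR m + e₂) * 3 := mul_le_mul_of_nonneg_left hP3 hE0
      _ ≤ max C 0 * (m : ℝ)⁻¹ * 3 := mul_le_mul_of_nonneg_right hE1 (by norm_num)
      _ = 3 * (max C 0 * (m : ℝ)⁻¹) := by ring
  have hfin : 3 * (max C 0 * (m : ℝ)⁻¹) < δ := by
    have h1 : 3 * max C 0 / δ < m := by linarith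
    rw [div_lt_iff₀ hδ] at h1
    rw [show 3 * (max C 0 * (m : ℝ)⁻¹) = 3 * max C 0 / m by ring, div_lt_iff₀ hm0]
    linarith [mul_comm (m : ℝ) δ]
  linarith

end soft

/-! ## The Ising instances (`softPackageNoBubble_criticalCorr`) -/

/-- **Stub 3 needs its guard**: `¬ ∀ m, 0 < ⟨σ₀σ_{e₂} ; σ_{up m}σ_{dn m}⟩_{β_c}` — the `m = 0`
instance of `stub_singlePinchPositive` is false (`T(e₂;0) = 0`). [folklore] -/
theorem singlePinchPositive_false_without_one_le :
    ¬ ∀ m : ℕ, 0 < TS cc2 (criticalCorr 3 4) e₂ m :=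
  singlePinchPositive_needs_one_le softPackageNoBubble_criticalCorr

/-- The critical single-pinch truncation at `m = 0` is `0`. [folklore] -/
theorem criticalTS_e₂_zero : TS cc2 (criticalCorr 3 4) e₂ 0 = 0 :=
  TS_e₂_zero softPackageNoBubble_criticalCorr

/-- **Stub 4's guard `1 ≤ s` is decorative**: its `s = 0` instances hold for every `c`. [folklore] -/
theorem quasiMultiplicative_instance_s_zero (c : ℝ) (m : ℕ) :
    c * avoidS cc2 (criticalCorr 3 4) e₂ 0 * avoidS cc2 (criticalCorr 3 4) (src 0) m ≤
      avoidS cc2 (criticalCorr 3 4) e₂ m :=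
  quasiMultiplicative_at_s_zero softPackageNoBubble_criticalCorr c m

/-- **Stub 2's guard `1 ≤ m` is decorative**: its `m = 0` instance holds. [folklore] -/
theorem unpinchedEnvelope_instance_m_zero :
    0 ≤ pairCovS cc2 (criticalCorr 3 4) (Pi.single 1 ((0 : ℕ) : ℤ)) (Pi.single 1 (-((0 : ℕ) : ℤ)))
        (up 0) (dn 0) ∧
      pairCovS cc2 (criticalCorr 3 4) (Pi.single 1 ((0 : ℕ) : ℤ)) (Pi.single 1 (-((0 : ℕ) : ℤ)))
          (up 0) (dn 0) ≤ 2 * criticalTwoPoint 3 (xR 0) ^ 2 :=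
  unpinchedEnvelope_at_m_zero softPackageNoBubble_criticalCorr

/-- **Stub 1 has no junk on the diagonal**: every instance `z = y` of `stub_rpUnpinch` holds. [folklore] -/
theorem rpUnpinch_instance_diag (m : ℕ) (y : Site 3) :
    pairCovS cc2 (criticalCorr 3 4) 0 e₂ y y ^ 2 ≤
      pairCovS cc2 (criticalCorr 3 4) 0 e₂ (xR m) (xR m + e₂) *
        pairCovS cc2 (criticalCorr 3 4) (mirror m y) (mirror m y) y y :=
  rpUnpinch_at_diag softPackageNoBubble_criticalCorr m y

/-- **Stub 1 needs its half-space guards**: for the critical correlators, the un-guarded minor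
`∀ m y z, ⟨ε_b;σ_yσ_z⟩² ≤ ⟨ε_b;ε_{θb}⟩·⟨σ_{θy}σ_{θz};σ_yσ_z⟩` is FALSE (witness `(y,z) = (0,e₂)`,
`m → ∞`). [folklore] -/
theorem rpUnpinch_false_without_halfspace :
    ¬ ∀ (m : ℕ) (y z : Site 3),
        pairCovS cc2 (criticalCorr 3 4) 0 e₂ y z ^ 2 ≤
          pairCovS cc2 (criticalCorr 3 4) 0 e₂ (xR m) (xR m + e₂) *
            pairCovS cc2 (criticalCorr 3 4) (mirror m y) (mirror m z) y z :=
  rpUnpinch_needs_halfspace softPackageNoBubble_criticalCorr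

/-- `⟨σ₀σ_{e₂}⟩_{β_c(3)} < 1` (from the package alone). [folklore] -/
theorem cc2_e₂_lt_one : cc2 0 e₂ < 1 := S_e₂_lt_one softPackageNoBubble_criticalCorr

end DrefuteLocal

end Summit.CriticalPhenomena.Ising3DConformalLimit.Theorems.GapForcesFarMerging.Negative

end
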